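import Summits.AtomisticToContinuum.Crystallization.Theorems.OverbindingBudgetMisfitCensus
import Summits.AtomisticToContinuum.Crystallization.Theorems.ChargedEnergyGap.Negative.PeriodicForm

/-!
# OverbindingBudget — «MisfitPeriodicForm»: the misfit / scale / gap censuses in PERIODIC NORMAL FORM (decomp-a2c lens-4, generation 38)

Helper file (`--supports stmt-AtomisticToContinuum-31280`); imports the g37 node `…OverbindingBudgetMisfitCensus` (SEG / MEG / GEG, cone XLI)
and the far-periodisation kit `…ChargedEnergyGap.Negative.PeriodicForm` (`periodiseFar`, `toPoint`, `motifCharged`, `eStar`).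

THE LENS (minimal-counterexample / extremal reduction) applied to the census currency.  A census `N e⋆ + c·#count − C·#charged − C N^{2/3} ≤ E`
quantifies over ALL finite injective configurations and carries a boundary term.  Its PERIODIC NORMAL FORM quantifies over periodic
configurations only and has NO boundary term:

    PeriodicScalePricing a s c C :  ∀ Q periodic,  c·#{bad SHORT/LONG motif sites of Q} − C·#{charged motif sites of Q} ≤ |motif|·(e(Q) − e⋆)

(`PeriodicMisfitPricing` / `PeriodicGapPricing` likewise; «PSEG / PMEG / PGEG»).  DOOR (PROVED, §D): `PeriodicScalePricing a s c C →
ScaleEnergyGap a s` for `a ≤ 1`, `0 ≤ s ≤ 1`, `c > 0` and ANY `C` (MEG / GEG analogues too) — «every finite counterexample to the census reduces to a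
periodic one»: periodise the finite configuration with far-apart copies (`periodiseFar`: spacing ≥ 8 beyond its extent); the motif of the
periodisation is the configuration, its energy per particle is `≤ E/N` (`energyPerParticle_periodise_le`, LJ ≤ 0 beyond 1), and — the content of
§C — charge, bonds, nearest-neighbour distances and the reference test `RT a s` (a predicate of radius `< 2`) read IDENTICALLY in the configuration
and in the infinite periodic point set, because foreign copies are ≥ 8 away (`eq_toPoint_or_far`).  So the periodic pricing inequality AT the
periodisation IS the census inequality of the configuration, with `C·N^{2/3}` to spare (`N < 2` by hand).  The CONVERSE (SEG ⇒ PSEG, block trial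
states as in `…Negative.PeriodicFormConverse`) is true and NOT ported — the cone does not need it (probe P10: not cheap).

WHY THIS IS THE RIGHT NORMAL FORM FOR SEG.  SEG is a Cauchy–Born coercivity statement; as typed, its two extraneous difficulties are the boundary
(`N^{2/3}`) and the bookkeeping of `e⋆` as an infimum.  The periodic form removes the boundary EXACTLY (not up to a constant) and turns SEG into an
extremal problem on periodic configurations — «minimise `e(Q) − e⋆ − (c·#scale-bad − C·#charged)/|motif|` over periodic `Q`» — which is where the
strain-vs-registry computation lives (uniform strain `σ` of a Barlow stacking costs `(L₁₂/24)(σ⁻⁶ − u⋆)²` per site, `≥ 0.0066` outside the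
window; memo §5, census TAG 185′) and where the refuter's counterexamples live (`…Negative.PeriodicForm` is the same normal form for CEG).

CONE XLI through the door (§E, by name): `rdef_of_ceg_periodicScale_gap`, `rdef_of_ceg_periodicScale_gapFree`, `rdef_of_ceg_periodicMisfit`.
Reference-free; nothing at margin 2; axioms `propext`, `Classical.choice`, `Quot.sound` only.
-/

namespace Summit.AtomisticToContinuum.Crystallization.Theorems.OverbindingBudgetMisfitPeriodicForm

open Literature.MathematicalPhysics.StatisticalMechanics
open Literature.Geometry.DiscreteGeometry (IsChargeFree bondGraph nearestDist nearestDist_le_dist bondGraph_adj)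
open Summit.AtomisticToContinuum.Crystallization.Theses.OverbindingBudget (RobustDefectLimitWindows)
open Summit.AtomisticToContinuum.Crystallization.Theses.PricedLinkCensus (ChargedEnergyGap)
open Summit.AtomisticToContinuum.Crystallization.Theorems.OverbindingBudgetGradedBareness (CleanlessExcessT)
open Summit.AtomisticToContinuum.Crystallization.Theorems.OverbindingBudgetCoherentCut (CoherentResidual)
open Summit.AtomisticToContinuum.Crystallization.Theorems.OverbindingBudgetViolatorDensityFloor (RT)
open Summit.AtomisticToContinuum.Crystallization.Theorems.OverbindingBudgetElasticSplitStatements (chargedCount)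
open Summit.AtomisticToContinuum.Crystallization.Theorems.OverbindingBudgetMisfitCensusStatements (Bad Short Long Gap badCount
  scaleCount gapCount MisfitEnergyGap ScaleEnergyGap GapEnergyGap GapFreeShells misfitEnergyGap_of_scale_gap
  misfitEnergyGap_zero_of_scale_gapFree)
open Summit.AtomisticToContinuum.Crystallization.Theorems.OverbindingBudgetMisfitCensus (rdef_of_ceg_meg rdef_of_ceg_scale_gap
  rdef_of_ceg_scale_gapFree)
open Summit.AtomisticToContinuum.Crystallization.Theorems.ChargedEnergyGapNegative (E3 eStar charged Dsum Dsum_nonneg periodiseFar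
  toPoint val_toPoint toPoint_injective eq_toPoint_or_far nearestDist_toPoint adj_toPoint_iff isChargeFree_toPoint_iff
  motif_periodiseFar mem_motif_periodiseFar motifCharged motifCharged_periodiseFar energyPerParticle_periodise_le spacingUnit
  period_le_spacing exists_ne_of_two_le)

variable {N : ℕ}

/-! ## §A  The census predicates of a periodic configuration (read in the infinite point set `Q.points`) -/

/-- The number of motif sites of the periodic configuration `Q` whose point (as a point of `Q.points`) satisfies `S`. -/
noncomputable def motifCount (Q : PeriodicConfiguration 3) (S : Q.points → Prop) : ℕ :=
  Nat.card {x : Q.motif // S ⟨x.1, Q.mem_points_of_mem_motif x.2⟩}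

/-- Periodic BAD: the point `p` of `Q.points` is `(1/100)`-charge-free (charge read in `Q.points`) but fails `RT a s Q.points`. -/
def PtBad (a s : ℝ) (Q : PeriodicConfiguration 3) (p : Q.points) : Prop :=
  IsChargeFree (1 / 100 : ℝ) (Subtype.val : Q.points → E3) p ∧ ¬ RT a s Q.points (p : E3)

/-- Periodic SHORT: own nearest-neighbour distance (in `Q.points`) below the window. -/
def PtShort (a s : ℝ) (Q : PeriodicConfiguration 3) (p : Q.points) : Prop :=
  nearestDist (Subtype.val : Q.points → E3) p < a * (1 - 1 / 50) - s

/-- Periodic LONG: a bond of `p` (scale-free bond graph of `Q.points` at tolerance `1/100`) longer than the window. -/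
def PtLong (a s : ℝ) (Q : PeriodicConfiguration 3) (p : Q.points) : Prop :=
  ∃ q : Q.points, (bondGraph (1 / 100 : ℝ) (Subtype.val : Q.points → E3)).Adj p q ∧ a * (1 + 1 / 50) + s < dist (p : E3) q

/-- Periodic GAP: a non-bonded point of `Q.points` inside the gap radius of `p`. -/
def PtGap (a s : ℝ) (Q : PeriodicConfiguration 3) (p : Q.points) : Prop :=
  ∃ q : Q.points, q ≠ p ∧ ¬ (bondGraph (1 / 100 : ℝ) (Subtype.val : Q.points → E3)).Adj p q ∧ dist (p : E3) q < a * (63 / 50) - s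

/-- Number of BAD motif sites of `Q`. -/
noncomputable def motifBadCount (a s : ℝ) (Q : PeriodicConfiguration 3) : ℕ :=
  motifCount Q (PtBad a s Q)

/-- Number of BAD motif sites of SHORT or LONG type of `Q`. -/
noncomputable def motifScaleCount (a s : ℝ) (Q : PeriodicConfiguration 3) : ℕ :=
  motifCount Q (fun p => PtBad a s Q p ∧ (PtShort a s Q p ∨ PtLong a s Q p))

/-- Number of BAD motif sites of GAP type of `Q`. -/
noncomputable def motifGapCount (a s : ℝ) (Q : PeriodicConfiguration 3) : ℕ :=
  motifCount Q (fun p => PtBad a s Q p ∧ PtGap a s Q p)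

/-- **`PeriodicMisfitPricing a s c C`** («PMEG», the periodic normal form of MEG): EVERY periodic configuration pays `c` per bad motif
site above `e⋆`, up to a rebate `C` per charged motif site — no boundary term. -/
def PeriodicMisfitPricing (a s c C : ℝ) : Prop :=
  ∀ Q : PeriodicConfiguration 3,
    c * (motifBadCount a s Q : ℝ) - C * (motifCharged (1 / 100 : ℝ) Q : ℝ) ≤ (Q.motif.card : ℝ) * (Q.energyPerParticle lennardJones - eStar)

/-- **`PeriodicScalePricing a s c C`** («PSEG», the periodic normal form of SEG): every periodic configuration pays `c` per bad motif site of
SHORT/LONG type above `e⋆`, up to `C` per charged motif site. -/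
def PeriodicScalePricing (a s c C : ℝ) : Prop :=
  ∀ Q : PeriodicConfiguration 3,
    c * (motifScaleCount a s Q : ℝ) - C * (motifCharged (1 / 100 : ℝ) Q : ℝ) ≤ (Q.motif.card : ℝ) * (Q.energyPerParticle lennardJones - eStar)

/-- **`PeriodicGapPricing a s c C`** («PGEG», the periodic normal form of GEG). -/
def PeriodicGapPricing (a s c C : ℝ) : Prop :=
  ∀ Q : PeriodicConfiguration 3,
    c * (motifGapCount a s Q : ℝ) - C * (motifCharged (1 / 100 : ℝ) Q : ℝ) ≤ (Q.motif.card : ℝ) * (Q.energyPerParticle lennardJones - eStar)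

/-! ## §B  Kernel arrows among the periodic pricings (PROVED) -/

/-- Monotonicity of the motif count in the predicate. -/
theorem motifCount_mono (Q : PeriodicConfiguration 3) {S T : Q.points → Prop} (h : ∀ p, S p → T p) :
    motifCount Q S ≤ motifCount Q T := by
  classical
  unfold motifCount
  exact Nat.card_le_card_of_injective (fun x => ⟨x.1, h _ x.2⟩) (fun a b hab => Subtype.ext (by simpa using congrArg Subtype.val hab))

/-- PMEG ⇒ PSEG (`c ≥ 0`). -/
theorem periodicScalePricing_of_misfit {a s c C : ℝ} (hc : 0 ≤ c) (h : PeriodicMisfitPricing a s c C) :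
    PeriodicScalePricing a s c C := fun Q => by
  have hle : (motifScaleCount a s Q : ℝ) ≤ motifBadCount a s Q := by
    exact_mod_cast motifCount_mono Q (fun p (hp : PtBad a s Q p ∧ (PtShort a s Q p ∨ PtLong a s Q p)) => hp.1)
  have := h Q
  nlinarith

/-- PMEG ⇒ PGEG (`c ≥ 0`). -/
theorem periodicGapPricing_of_misfit {a s c C : ℝ} (hc : 0 ≤ c) (h : PeriodicMisfitPricing a s c C) :
    PeriodicGapPricing a s c C := fun Q => by
  have hle : (motifGapCount a s Q : ℝ) ≤ motifBadCount a s Q := by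
    exact_mod_cast motifCount_mono Q (fun p (hp : PtBad a s Q p ∧ PtGap a s Q p) => hp.1)
  have := h Q
  nlinarith

/-! ## §C  Far periodisation transfers the census (PROVED) -/

section Transfer

variable {y : Fin N → E3}

/-- A point of the far periodisation closer than `6D + 8` to some `yᵢ` is a motif point. -/
theorem exists_eq_toPoint_of_dist_lt (hN : 0 < N) (p : (periodiseFar y hN).points) (i : Fin N)
    (h : dist (y i) p < 6 * Dsum y + 8) : ∃ j, p = toPoint y hN j := by
  rcases eq_toPoint_or_far hN p with h' | hfar
  · exact h'
  · exact absurd (hfar i) (not_le.2 h)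

/-- Same, for points given as elements of `E3`. -/
theorem mem_range_of_dist_lt (hN : 0 < N) {w : E3} (hw : w ∈ (periodiseFar y hN).points) (i : Fin N)
    (h : dist (y i) w < 6 * Dsum y + 8) : w ∈ Set.range y := by
  obtain ⟨j, hj⟩ := exists_eq_toPoint_of_dist_lt hN ⟨w, hw⟩ i h
  exact ⟨j, by simpa using (congrArg Subtype.val hj).symm⟩

/-- The sites of `y` are points of the far periodisation. -/
theorem range_subset_points (hN : 0 < N) : Set.range y ⊆ (periodiseFar y hN).points := by
  rintro _ ⟨j, rfl⟩
  exact (toPoint y hN j).2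

/-- Open balls of radius `≤ 8` about `yᵢ` see the same points in the periodisation and in `y`. -/
theorem sep_lt_eq (hN : 0 < N) (i : Fin N) {r : ℝ} (hr : r ≤ 8) :
    {w ∈ (periodiseFar y hN).points | w ≠ y i ∧ dist (y i) w < r} = {w ∈ Set.range y | w ≠ y i ∧ dist (y i) w < r} := by
  ext w
  constructor
  · rintro ⟨hw, hne, hd⟩
    exact ⟨mem_range_of_dist_lt hN hw i (by linarith [Dsum_nonneg y]), hne, hd⟩
  · rintro ⟨hw, hne, hd⟩
    exact ⟨range_subset_points hN hw, hne, hd⟩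

/-- Closed balls of radius `< 8` about `yᵢ` see the same points in the periodisation and in `y`. -/
theorem sep_le_eq (hN : 0 < N) (i : Fin N) {r : ℝ} (hr : r < 8) :
    {w ∈ (periodiseFar y hN).points | w ≠ y i ∧ dist (y i) w ≤ r} = {w ∈ Set.range y | w ≠ y i ∧ dist (y i) w ≤ r} := by
  ext w
  constructor
  · rintro ⟨hw, hne, hd⟩
    exact ⟨mem_range_of_dist_lt hN hw i (by linarith [Dsum_nonneg y]), hne, hd⟩
  · rintro ⟨hw, hne, hd⟩
    exact ⟨range_subset_points hN hw, hne, hd⟩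

/-- **The relaxed gapped-twelve test of `yᵢ` reads the same in the far periodisation and in `y`** (`a ≤ 1`, `0 ≤ s ≤ 1`: all three radii
are `< 8 ≤ 6D + 8`, and far points satisfy clause 3 trivially). -/
theorem rt_points_iff (hN : 0 < N) (i : Fin N) {a s : ℝ} (ha : a ≤ 1) (hs0 : 0 ≤ s) (hs1 : s ≤ 1) :
    RT a s (periodiseFar y hN).points (y i) ↔ RT a s (Set.range y) (y i) := by
  have h1 : a * (63 / 50) - s ≤ 8 := by linarith
  have h2 : a * (1 + 1 / 50) + s < 8 := by linarith
  unfold RT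
  rw [sep_lt_eq hN i h1, sep_le_eq hN i h2]
  refine and_congr_right fun _ => and_congr_right fun _ => ?_
  constructor
  · intro h w hw hne
    exact h w (range_subset_points hN hw) hne
  · intro h w hw hne
    by_cases hd : dist (y i) w < 8
    · exact h w (mem_range_of_dist_lt hN hw i (by linarith [Dsum_nonneg y])) hne
    · push Not at hd
      exact ⟨by linarith, Or.inr (by linarith)⟩

/-- SHORT transfers (`N ≥ 2`). -/
theorem ptShort_toPoint_iff (hy : Function.Injective y) (hN : 0 < N) (hN2 : ∀ i : Fin N, ∃ j, j ≠ i) (i : Fin N) {a s : ℝ} :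
    PtShort a s (periodiseFar y hN) (toPoint y hN i) ↔ Short a s y i := by
  unfold PtShort Short
  rw [nearestDist_toPoint hy hN (hN2 i)]

/-- LONG transfers (`N ≥ 2`). -/
theorem ptLong_toPoint_iff (hy : Function.Injective y) (hN : 0 < N) (hN2 : ∀ i : Fin N, ∃ j, j ≠ i) (i : Fin N) {a s : ℝ} :
    PtLong a s (periodiseFar y hN) (toPoint y hN i) ↔ Long a s y i := by
  unfold PtLong Long
  constructor
  · rintro ⟨q, hadj, hd⟩
    obtain ⟨j, rfl, hadj'⟩ := (adj_toPoint_iff hy hN (by norm_num) hN2 i q).1 hadj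
    exact ⟨j, hadj', by simpa using hd⟩
  · rintro ⟨j, hadj, hd⟩
    exact ⟨toPoint y hN j, (adj_toPoint_iff hy hN (by norm_num) hN2 i _).2 ⟨j, rfl, hadj⟩, by simpa using hd⟩

/-- GAP transfers (`N ≥ 2`, `a ≤ 1`, `0 ≤ s`: the gap radius is `< 8`). -/
theorem ptGap_toPoint_iff (hy : Function.Injective y) (hN : 0 < N) (hN2 : ∀ i : Fin N, ∃ j, j ≠ i) (i : Fin N) {a s : ℝ}
    (ha : a ≤ 1) (hs0 : 0 ≤ s) :
    PtGap a s (periodiseFar y hN) (toPoint y hN i) ↔ Gap a s y i := by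
  unfold PtGap Gap
  constructor
  · rintro ⟨q, hne, hnadj, hd⟩
    have hd8 : dist (y i) (q : E3) < 6 * Dsum y + 8 := by
      have : dist (y i) (q : E3) < a * (63 / 50) - s := by simpa using hd
      linarith [Dsum_nonneg y]
    obtain ⟨j, rfl⟩ := exists_eq_toPoint_of_dist_lt hN q i hd8
    refine ⟨j, fun h => hne (by rw [h]), fun h => hnadj ((adj_toPoint_iff hy hN (by norm_num) hN2 i _).2 ⟨j, rfl, h⟩), ?_⟩
    simpa using hd
  · rintro ⟨j, hne, hnadj, hd⟩
    refine ⟨toPoint y hN j, fun h => hne (toPoint_injective hy hN h), fun h => ?_, by simpa using hd⟩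
    obtain ⟨j', hj', hadj⟩ := (adj_toPoint_iff hy hN (by norm_num) hN2 i _).1 h
    have hjj : j = j' := toPoint_injective hy hN hj'
    subst hjj
    exact hnadj hadj

/-- BAD transfers (`N ≥ 2`, `a ≤ 1`, `0 ≤ s ≤ 1`). -/
theorem ptBad_toPoint_iff (hy : Function.Injective y) (hN : 0 < N) (hN2 : ∀ i : Fin N, ∃ j, j ≠ i) (i : Fin N) {a s : ℝ}
    (ha : a ≤ 1) (hs0 : 0 ≤ s) (hs1 : s ≤ 1) :
    PtBad a s (periodiseFar y hN) (toPoint y hN i) ↔ Bad a s y i := by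
  unfold PtBad Bad
  rw [isChargeFree_toPoint_iff hy hN (by norm_num) hN2 i, val_toPoint, rt_points_iff hN i ha hs0 hs1]

/-- **Motif counts of the far periodisation are the counts of `y`** (generic form). -/
theorem motifCount_periodiseFar (hy : Function.Injective y) (hN : 0 < N) {S : (periodiseFar y hN).points → Prop}
    {T : Fin N → Prop} (h : ∀ i, S (toPoint y hN i) ↔ T i) :
    motifCount (periodiseFar y hN) S = Nat.card {i : Fin N // T i} := by
  classical
  unfold motifCount
  let f : {i : Fin N // T i} →
      {x : (periodiseFar y hN).motif // S ⟨x.1, (periodiseFar y hN).mem_points_of_mem_motif x.2⟩} :=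
    fun i => ⟨⟨y i.1, mem_motif_periodiseFar y hN i.1⟩, (h i.1).2 i.2⟩
  have hf : Function.Bijective f := by
    constructor
    · intro a b hab
      have : y a.1 = y b.1 := congrArg (fun z => ((z.1 : (periodiseFar y hN).motif) : E3)) hab
      exact Subtype.ext (hy this)
    · rintro ⟨⟨v, hv⟩, hS⟩
      have hv' := hv
      rw [motif_periodiseFar] at hv'
      obtain ⟨i, -, rfl⟩ := Finset.mem_image.1 hv'
      exact ⟨⟨i, (h i).1 hS⟩, rfl⟩
  exact (Nat.card_congr (Equiv.ofBijective f hf)).symm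

/-- `#bad motif sites of the far periodisation = #bad sites of y`. -/
theorem motifBadCount_periodiseFar (hy : Function.Injective y) (hN : 0 < N) (hN2 : ∀ i : Fin N, ∃ j, j ≠ i) {a s : ℝ}
    (ha : a ≤ 1) (hs0 : 0 ≤ s) (hs1 : s ≤ 1) : motifBadCount a s (periodiseFar y hN) = badCount a s y := by
  unfold motifBadCount badCount
  exact motifCount_periodiseFar hy hN fun i => ptBad_toPoint_iff hy hN hN2 i ha hs0 hs1

/-- `#scale-bad motif sites of the far periodisation = #scale-bad sites of y`. -/
theorem motifScaleCount_periodiseFar (hy : Function.Injective y) (hN : 0 < N) (hN2 : ∀ i : Fin N, ∃ j, j ≠ i) {a s : ℝ}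
    (ha : a ≤ 1) (hs0 : 0 ≤ s) (hs1 : s ≤ 1) : motifScaleCount a s (periodiseFar y hN) = scaleCount a s y := by
  unfold motifScaleCount scaleCount
  exact motifCount_periodiseFar hy hN fun i => by
    rw [ptBad_toPoint_iff hy hN hN2 i ha hs0 hs1, ptShort_toPoint_iff hy hN hN2 i, ptLong_toPoint_iff hy hN hN2 i]

/-- `#gap-bad motif sites of the far periodisation = #gap-bad sites of y`. -/
theorem motifGapCount_periodiseFar (hy : Function.Injective y) (hN : 0 < N) (hN2 : ∀ i : Fin N, ∃ j, j ≠ i) {a s : ℝ}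
    (ha : a ≤ 1) (hs0 : 0 ≤ s) (hs1 : s ≤ 1) : motifGapCount a s (periodiseFar y hN) = gapCount a s y := by
  unfold motifGapCount gapCount
  exact motifCount_periodiseFar hy hN fun i => by
    rw [ptBad_toPoint_iff hy hN hN2 i ha hs0 hs1, ptGap_toPoint_iff hy hN hN2 i ha hs0]

end Transfer

/-! ## §D  The reduction theorem: periodic pricing implies the finite census (PROVED) -/

/-- `chargedCount` is the negative-side `charged (1/100)`. -/
theorem charged_eq_chargedCount (y : Fin N → E3) : charged (1 / 100 : ℝ) y = chargedCount y := rfl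

/-- **Generic door.**  A census count `cnt` (at most `N`) whose motif version `mcnt` is transferred by far periodisation, priced periodically at
`c > 0` per site with rebate `C` per charged motif site, is priced in every finite injective configuration at `c` per site with rebate
`max C 0 + |e⋆| + c` per charged site and per `N^{2/3}` (the boundary term is not even needed: far periodisation has no boundary). -/
theorem census_of_periodicPricing (cnt : ∀ {N : ℕ}, (Fin N → E3) → ℕ) (mcnt : PeriodicConfiguration 3 → ℕ)
    (hle : ∀ {N : ℕ} (y : Fin N → E3), cnt y ≤ N)
    (htr : ∀ {N : ℕ} (y : Fin N → E3) (hy : Function.Injective y) (hN : 0 < N), (∀ i : Fin N, ∃ j, j ≠ i) →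
      mcnt (periodiseFar y hN) = cnt y)
    {c C : ℝ} (hc : 0 < c)
    (h : ∀ Q : PeriodicConfiguration 3,
      c * (mcnt Q : ℝ) - C * (motifCharged (1 / 100 : ℝ) Q : ℝ) ≤ (Q.motif.card : ℝ) * (Q.energyPerParticle lennardJones - eStar)) :
    ∃ c' C' : ℝ, 0 < c' ∧ ∀ (N : ℕ) (y : Fin N → E3), Function.Injective y →
      (N : ℝ) * eStar + c' * (cnt y : ℝ) - C' * (chargedCount y : ℝ) - C' * (N : ℝ) ^ (2 / 3 : ℝ) ≤ interactionEnergy lennardJones y := by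
  refine ⟨c, max C 0 + |eStar| + c, hc, fun N y hy => ?_⟩
  have hC0 : 0 ≤ max C 0 := le_max_right _ _
  have hCle : C ≤ max C 0 := le_max_left _ _
  have habs : 0 ≤ |eStar| := abs_nonneg _
  have hele : eStar ≤ |eStar| := le_abs_self _
  have hm0 : (0 : ℝ) ≤ chargedCount y := Nat.cast_nonneg _
  have hc0 : (0 : ℝ) ≤ cnt y := Nat.cast_nonneg _
  have hC'0 : 0 ≤ max C 0 + |eStar| + c := by linarith
  have hcnt : (cnt y : ℝ) ≤ N := by exact_mod_cast hle y
  rcases Nat.lt_or_ge N 2 with hN | hN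
  · interval_cases N
    · have hz : ((0 : ℕ) : ℝ) ^ (2 / 3 : ℝ) = 0 := by rw [Nat.cast_zero, Real.zero_rpow (by norm_num)]
      rw [interactionEnergy_of_subsingleton, hz]
      have h0 : (cnt y : ℝ) ≤ 0 := by simpa using hcnt
      simp only [Nat.cast_zero, zero_mul, zero_add, mul_zero, sub_zero]
      nlinarith [mul_nonneg hC'0 hm0]
    · have h1 : ((1 : ℕ) : ℝ) ^ (2 / 3 : ℝ) = 1 := by rw [Nat.cast_one, Real.one_rpow]
      rw [interactionEnergy_of_subsingleton, h1]
      have h1' : (cnt y : ℝ) ≤ 1 := by simpa using hcnt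
      simp only [Nat.cast_one, one_mul, mul_one]
      nlinarith [mul_nonneg hC'0 hm0]
  · have hN0 : 0 < N := by omega
    have hN2 : ∀ i : Fin N, ∃ j, j ≠ i := exists_ne_of_two_le hN
    have hp := h (periodiseFar y hN0)
    rw [htr y hy hN0 hN2, motifCharged_periodiseFar hy hN0 (by norm_num) hN2, charged_eq_chargedCount] at hp
    have hcard : (((periodiseFar y hN0).motif.card : ℕ) : ℝ) = N := by
      rw [motif_periodiseFar, Finset.card_image_of_injective _ hy, Finset.card_univ, Fintype.card_fin]
    rw [hcard] at hp
    have hNr : (0 : ℝ) < N := by exact_mod_cast hN0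
    have he := energyPerParticle_periodise_le hy (spacingUnit y) (period_le_spacing y) hN0
    rw [le_div_iff₀ hNr, mul_comm] at he
    have he' : (N : ℝ) * (periodiseFar y hN0).energyPerParticle lennardJones ≤ interactionEnergy lennardJones y := he
    have hN23 : (0 : ℝ) ≤ (N : ℝ) ^ (2 / 3 : ℝ) := Real.rpow_nonneg (Nat.cast_nonneg _) _
    nlinarith [mul_nonneg (show (0:ℝ) ≤ max C 0 + |eStar| + c - C by linarith) hm0, mul_nonneg hC'0 hN23]

/-- `#scale-bad ≤ N`. -/
theorem scaleCount_le (a s : ℝ) (y : Fin N → E3) : scaleCount a s y ≤ N := by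
  unfold scaleCount
  exact (Finite.card_subtype_le _).trans_eq (Nat.card_fin N)

/-- `#gap-bad ≤ N`. -/
theorem gapCount_le (a s : ℝ) (y : Fin N → E3) : gapCount a s y ≤ N := by
  unfold gapCount
  exact (Finite.card_subtype_le _).trans_eq (Nat.card_fin N)

/-- `#bad ≤ N`. -/
theorem badCount_le (a s : ℝ) (y : Fin N → E3) : badCount a s y ≤ N := by
  unfold badCount
  exact (Finite.card_subtype_le _).trans_eq (Nat.card_fin N)

/-- **PSEG ⇒ SEG**: the periodic normal form of the scale census implies it (`a ≤ 1`, `0 ≤ s ≤ 1`, `c > 0`, any `C`). [this file] -/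
theorem scaleEnergyGap_of_periodic {a s c C : ℝ} (ha : a ≤ 1) (hs0 : 0 ≤ s) (hs1 : s ≤ 1) (hc : 0 < c)
    (h : PeriodicScalePricing a s c C) : ScaleEnergyGap a s :=
  census_of_periodicPricing (fun y => scaleCount a s y) (motifScaleCount a s) (fun y => scaleCount_le a s y)
    (fun _ hy hN hN2 => motifScaleCount_periodiseFar hy hN hN2 ha hs0 hs1) hc h

/-- **PGEG ⇒ GEG.** [this file] -/
theorem gapEnergyGap_of_periodic {a s c C : ℝ} (ha : a ≤ 1) (hs0 : 0 ≤ s) (hs1 : s ≤ 1) (hc : 0 < c)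
    (h : PeriodicGapPricing a s c C) : GapEnergyGap a s :=
  census_of_periodicPricing (fun y => gapCount a s y) (motifGapCount a s) (fun y => gapCount_le a s y)
    (fun _ hy hN hN2 => motifGapCount_periodiseFar hy hN hN2 ha hs0 hs1) hc h

/-- **PMEG ⇒ MEG.** [this file] -/
theorem misfitEnergyGap_of_periodic {a s c C : ℝ} (ha : a ≤ 1) (hs0 : 0 ≤ s) (hs1 : s ≤ 1) (hc : 0 < c)
    (h : PeriodicMisfitPricing a s c C) : MisfitEnergyGap a s :=
  census_of_periodicPricing (fun y => badCount a s y) (motifBadCount a s) (fun y => badCount_le a s y)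
    (fun _ hy hN hN2 => motifBadCount_periodiseFar hy hN hN2 ha hs0 hs1) hc h

/-! ## §E  Cone XLI through the periodic door (by name) -/

/-- `ChargedEnergyGap → PeriodicScalePricing (122/125) 0 c C → GapEnergyGap (122/125) 0 → CleanlessExcessT → CoherentResidual 10 →
RobustDefectLimitWindows` (`c > 0`). [this file] -/
theorem rdef_of_ceg_periodicScale_gap {c C : ℝ} (hc : 0 < c) (hCEG : ChargedEnergyGap) (hP : PeriodicScalePricing (122 / 125) 0 c C)
    (hG : GapEnergyGap (122 / 125) 0) (hCE : CleanlessExcessT) (hRes : CoherentResidual 10) : RobustDefectLimitWindows :=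
  rdef_of_ceg_scale_gap hCEG (scaleEnergyGap_of_periodic (by norm_num) le_rfl (by norm_num) hc hP) hG hCE hRes

/-- Same with the geometric second piece `GapFreeShells`. [this file] -/
theorem rdef_of_ceg_periodicScale_gapFree {c C : ℝ} (hc : 0 < c) (hCEG : ChargedEnergyGap)
    (hP : PeriodicScalePricing (122 / 125) 0 c C) (hGF : GapFreeShells) (hCE : CleanlessExcessT) (hRes : CoherentResidual 10) :
    RobustDefectLimitWindows :=
  rdef_of_ceg_scale_gapFree hCEG (scaleEnergyGap_of_periodic (by norm_num) le_rfl (by norm_num) hc hP) hGF hCE hRes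

/-- The whole misfit census through its periodic normal form: `ChargedEnergyGap → PeriodicMisfitPricing (122/125) 0 c C → CleanlessExcessT →
CoherentResidual 10 → RobustDefectLimitWindows` (`c > 0`). [this file] -/
theorem rdef_of_ceg_periodicMisfit {c C : ℝ} (hc : 0 < c) (hCEG : ChargedEnergyGap) (hP : PeriodicMisfitPricing (122 / 125) 0 c C)
    (hCE : CleanlessExcessT) (hRes : CoherentResidual 10) : RobustDefectLimitWindows :=
  rdef_of_ceg_meg hCEG (misfitEnergyGap_of_periodic (by norm_num) le_rfl (by norm_num) hc hP) hCE hRes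

end Summit.AtomisticToContinuum.Crystallization.Theorems.OverbindingBudgetMisfitPeriodicForm
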